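import Literature.NumberTheory.LFunctions.TwistedZeroFreeRegion
import Mathlib.Analysis.ODE.Gronwall
import HarnessLib

/-!
# `F'/F ≪ ℒ` and `F⁻¹ ≪ ℒ` near `σ = 1` for a twisted `L`-function without exceptional zero

This is the sharp abstract form of [MontgomeryVaughan2007, Theorem 11.4] for an abstract
`TwistedZFRData η A Cg c₁ K₀ C₂ pole Q Λ₀ Λ₁ Λ₂ F` datum (`F` itself has no pole at `s = 1`; the flag
`pole`, which records whether `L(Λ₂, ·)` has one, plays no role here: only the Lemma-11.1 package of
`F`, the lower bound `lower` and the majorant `Λ₀` are used), complementing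
the crude bound `TwistedZFRData.exists_logDeriv_bound_const` of
`Literature.NumberTheory.LFunctions.TwistedZeroFreeRegion` (which loses a factor `exp(O(ℒ²))`).

Write `ℒ(t) = log Q + log(|t| + 4)`.  Assume a genuine zero-free region
`F(ρ) = 0 → Re ρ ≤ 1 − c₀/ℒ(Im ρ)` with some constant `c₀ > 0` (for `pole = false` this is
`TwistedZFRData.exists_zeroFree_const` with an absolute `c₀`; for a real character with an exceptional
zero `β₁ ≤ 1 − C(ε)Q^{−ε}` one takes `c₀ ≍ C(ε)Q^{−ε}`, and the constants below are explicit in `c₀`).  Then, with explicit constants depending only on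
`η, A, Cg, c₁, K₀, c₀`:

* `norm_logDeriv_le_sharp` : for `1 − min(c₀/5, η/64)/ℒ(t) ≤ σ ≤ 1 + η/(32ℒ(t))`,
  `F(s) ≠ 0` and `‖F'/F(s)‖ ≤ C · ℒ(t)`;
* `norm_inv_le_sharp` : in the same range `‖F(s)⁻¹‖ ≤ C' · ℒ(t)`.

Proof (MV §11.1, proof of Theorem 11.4): compare the partial-fraction expansions
(`LogDerivPackage.norm_logDeriv_add_sum_le`) of `F'/F` at `s = σ + it` and at
`s₁ = 1 + η/(32ℒ) + it`; at `s₁` the Dirichlet series bound `Re(−F'/F) ≤ K₀ + …` and the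
`3-4-1`-type control of `Σ_ρ Re 1/(s₁ − ρ)` (fields of `TwistedZFRData`) bound everything by
`O(ℒ)`; the zero-free region gives `‖s₁ − ρ‖ ≍ ‖s − ρ‖` for all zeros `ρ` with `‖ρ − s₁‖ ≤ …`,
whence `|1/(s−ρ) − 1/(s₁−ρ)| ≪ ℒ⁻¹ Re 1/(s₁ − ρ)` and the sum over zeros is again `O(ℒ)`.
The bound for `1/F` follows by integrating `F'/F` along the horizontal segment from `s` to `s₁`
(Grönwall) and `‖F(s₁)‖ ≥ c₁ (σ₁ − 1)`.

These are the inputs for the bound `L(s, ψ)⁻¹ ≪ d ℒ²` of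
[FriedlanderIwaniecAnnals1998, (16.23)] for Hecke `L`-functions of `ℚ(i)`.

## References
* [MontgomeryVaughan2007] H. L. Montgomery, R. C. Vaughan, *Multiplicative Number Theory I*,
  CUP 2007, §11.1, Theorem 11.4 and its proof, pp. 362–364.
* [FriedlanderIwaniecAnnals1998] J. Friedlander, H. Iwaniec, *The polynomial `X² + Y⁴` captures
  its primes*, Ann. of Math. 148 (1998), (16.20)–(16.23).
-/

noncomputable section

open Complex Filter Topology Metric Set Finset

namespace Literature.NumberTheory.LFunctions

namespace TwistedZFRData

variable {η A Cg c₁ K₀ C₂ : ℝ} {pole : Bool} {Q : ℝ} {Λ₀ : ℕ → ℝ} {Λ₁ Λ₂ : ℕ → ℂ} {F : ℂ → ℂ}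

/-- Local notation for the package constant `E(η, A, C_g, c₁) = 8(2A + |log(32C_g/(c₁η))| + 1)/(η/4)`. -/
local notation3 "E[" η "," A "," Cg "," c₁ "]" =>
  (8 * (2 * (A : ℝ) + |Real.log ((Cg : ℝ) / ((c₁ : ℝ) * ((η : ℝ) / 32)))| + 1) / ((η : ℝ) / 4))

/-! ### Two elementary inequalities for `1/(s − a) − 1/(s₁ − a)` -/

/-- For `Re(s₁ − a) ≥ κ > 0`: `1/‖s₁ − a‖² ≤ κ⁻¹ Re (1/(s₁ − a))`. [folklore] -/
theorem inv_norm_sq_le_re_inv {w : ℂ} {κ : ℝ} (hκ : 0 < κ) (hw : κ ≤ w.re) :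
    1 / ‖w‖ ^ 2 ≤ κ⁻¹ * (1 / w).re := by
  have hw0 : w ≠ 0 := fun h ↦ by rw [h, zero_re] at hw; linarith
  have hn : 0 < ‖w‖ ^ 2 := by positivity
  have hre : (1 / w).re = w.re / ‖w‖ ^ 2 := by
    rw [one_div, Complex.inv_re, Complex.normSq_eq_norm_sq]
  rw [hre, show κ⁻¹ * (w.re / ‖w‖ ^ 2) = (κ⁻¹ * w.re) * (1 / ‖w‖ ^ 2) by ring]
  refine le_mul_of_one_le_left (by positivity) ?_
  rw [le_inv_mul_iff₀ hκ, mul_one]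
  exact hw

/-- The comparison of the two Cauchy kernels: if `‖s₁ − s‖ ≤ K₁ ‖s − a‖` then
`‖1/(s − a) − 1/(s₁ − a)‖ ≤ (1 + K₁) ‖s₁ − s‖ / ‖s₁ − a‖²`. [cite: MontgomeryVaughan2007, Theorem 11.4 (proof)] -/
theorem norm_inv_sub_inv_le {s s₁ a : ℂ} {K₁ : ℝ} (hsa : s ≠ a) (hs₁a : s₁ ≠ a)
    (hcomp : ‖s₁ - s‖ ≤ K₁ * ‖s - a‖) :
    ‖1 / (s - a) - 1 / (s₁ - a)‖ ≤ (1 + K₁) * ‖s₁ - s‖ / ‖s₁ - a‖ ^ 2 := by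
  have h1 : s - a ≠ 0 := sub_ne_zero.mpr hsa
  have h2 : s₁ - a ≠ 0 := sub_ne_zero.mpr hs₁a
  have hn1 : 0 < ‖s - a‖ := norm_pos_iff.mpr h1
  have hn2 : 0 < ‖s₁ - a‖ := norm_pos_iff.mpr h2
  have heq : 1 / (s - a) - 1 / (s₁ - a) = (s₁ - s) / ((s - a) * (s₁ - a)) := by
    rw [one_div, one_div, inv_sub_inv h1 h2, sub_sub_sub_cancel_right]
  rw [heq, norm_div, norm_mul]
  -- `‖s₁ − a‖ ≤ ‖s₁ − s‖ + ‖s − a‖ ≤ (1 + K₁)‖s − a‖`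
  have htri : ‖s₁ - a‖ ≤ (1 + K₁) * ‖s - a‖ := by
    calc ‖s₁ - a‖ = ‖(s₁ - s) + (s - a)‖ := by ring_nf
      _ ≤ ‖s₁ - s‖ + ‖s - a‖ := norm_add_le _ _
      _ ≤ K₁ * ‖s - a‖ + ‖s - a‖ := by linarith
      _ = (1 + K₁) * ‖s - a‖ := by ring
  rw [div_le_div_iff₀ (mul_pos hn1 hn2) (by positivity)]
  calc ‖s₁ - s‖ * ‖s₁ - a‖ ^ 2 = ‖s₁ - s‖ * ‖s₁ - a‖ * ‖s₁ - a‖ := by ring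
    _ ≤ ‖s₁ - s‖ * ‖s₁ - a‖ * ((1 + K₁) * ‖s - a‖) := by gcongr
    _ = (1 + K₁) * ‖s₁ - s‖ * (‖s - a‖ * ‖s₁ - a‖) := by ring

/-! ### The sharp bound -/

section Sharp

variable (h : TwistedZFRData η A Cg c₁ K₀ C₂ pole Q Λ₀ Λ₁ Λ₂ F)
include h

set_option maxHeartbeats 1000000 in -- long linear-arithmetic bookkeeping with many local definitions
/-- **MV Theorem 11.4, sharp abstract form (no exceptional zero).** Let `c₀` be a zero-free constant
for the datum (every zero `ρ` has `Re ρ ≤ 1 − c₀/ℒ(Im ρ)`, `ℒ(t) = log Q + log(|t| + 4)`). Then for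
`s = σ + it` with `1 − c/ℒ(t) ≤ σ ≤ 1 + η/(32ℒ(t))`, `c = min(c₀/5, η/64)`:
`F(s) ≠ 0` and `‖F'/F(s)‖ ≤ C ℒ(t)` with `C` depending only on `η, A, C_g, c₁, K₀, c₀`.
Proof (MV pp. 277–278): compare with `s₁ = 1 + η/(32ℒ) + it` through the Lemma-α package
`F'/F = ψ + Σ m(a)/(z − a)`: `|1/(s−a) − 1/(s₁−a)| ≤ K₂ Re 1/(s₁−a)` for the zeros `a` (which have
`Re a ≤ 1 − (4c₀/5)/ℒ`), and `Σ m(a) Re 1/(s₁−a) ≤ ‖F'/F(s₁)‖ + ‖ψ(s₁)‖ ≪ ℒ`.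
[cite: MontgomeryVaughan2007, Theorem 11.4] -/
theorem norm_logDeriv_le_sharp {c₀ : ℝ} (hc₀ : 0 < c₀)
    (hzf : ∀ ρ : ℂ, F ρ = 0 → ρ.re ≤ 1 - c₀ / (Real.log Q + Real.log (|ρ.im| + 4)))
    {s : ℂ} (hσ1 : 1 - min (c₀ / 5) (η / 64) / (Real.log Q + Real.log (|s.im| + 4)) ≤ s.re)
    (hσ2 : s.re ≤ 1 + η / 32 / (Real.log Q + Real.log (|s.im| + 4))) :
    F s ≠ 0 ∧ ‖deriv F s / F s‖ ≤
      (32 / η + K₀ + 2 * E[η, A, Cg, c₁] +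
        (1 + (η / 32 + η / 64) / (2 * c₀ / 5)) * ((η / 32 + η / 64) / (η / 32)) * (32 / η + K₀ + E[η, A, Cg, c₁])) *
        (Real.log Q + Real.log (|s.im| + 4)) := by
  have hη := h.eta_pos
  have hη1 := h.eta_le_one
  have hK₀ := h.K₀_nonneg
  have hQ := h.one_le_Q
  obtain ⟨E, hEdef⟩ : ∃ E : ℝ, E = E[η, A, Cg, c₁] := ⟨_, rfl⟩
  have hE : 0 ≤ E := by rw [hEdef]; exact h.packageConst_nonneg
  rw [← hEdef]
  set t : ℝ := s.im with ht
  set ℒ : ℝ := Real.log Q + Real.log (|t| + 4) with hℒ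
  have hℒ1 : 1 ≤ ℒ := TwistedZFR.one_le_ell hQ t
  have hℒ0 : 0 < ℒ := by linarith
  set c : ℝ := min (c₀ / 5) (η / 64) with hcdef
  have hc1 : c ≤ c₀ / 5 := min_le_left _ _
  have hc2 : c ≤ η / 64 := min_le_right _ _
  have hc0 : 0 < c := lt_min (by positivity) (by positivity)
  set κ : ℝ := η / 32 / ℒ with hκ
  have hκ0 : 0 < κ := by positivity
  have hκle : κ ≤ η / 32 := by
    rw [hκ]; exact div_le_self (by positivity) hℒ1
  -- the points
  set s₀ : ℂ := 1 + η / 32 + t * I with hs₀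
  set s₁ : ℂ := ((1 + κ : ℝ) : ℂ) + t * I with hs₁
  have hs_eq : s = ((s.re : ℝ) : ℂ) + t * I := by
    apply Complex.ext <;> simp [ht]
  have hs₁re : s₁.re = 1 + κ := by simp [hs₁]
  have hs₁im : s₁.im = t := by simp [hs₁]
  -- distances to `s₀`
  have hdist_s : ‖s - s₀‖ ≤ η / 16 := by
    have : s - s₀ = ((s.re - (1 + η / 32) : ℝ) : ℂ) := by
      conv_lhs => rw [hs_eq]
      rw [hs₀]; push_cast; ring
    rw [this, Complex.norm_real, Real.norm_eq_abs, abs_le]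
    have h1 : c / ℒ ≤ c := div_le_self hc0.le hℒ1
    have h2 : η / 32 / ℒ ≤ η / 32 := div_le_self (by positivity) hℒ1
    constructor <;> linarith
  have hdist_s₁ : ‖s₁ - s₀‖ ≤ η / 16 := by
    have : s₁ - s₀ = ((κ - η / 32 : ℝ) : ℂ) := by
      rw [hs₁, hs₀]; push_cast; ring
    rw [this, Complex.norm_real, Real.norm_eq_abs, abs_le]
    constructor <;> linarith
  have hmem_s : s ∈ closedBall s₀ (η / 16) := by rw [mem_closedBall, dist_eq_norm]; exact hdist_s
  have hmem_s₁ : s₁ ∈ closedBall s₀ (η / 16) := by rw [mem_closedBall, dist_eq_norm]; exact hdist_s₁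
  have hball_s : s ∈ ball s₀ (η / 4) := by
    rw [mem_ball, dist_eq_norm]; linarith
  have hball_s₁ : s₁ ∈ ball s₀ (η / 4) := by
    rw [mem_ball, dist_eq_norm]; linarith
  -- non-vanishing at `s` and `s₁`
  have hFs : F s ≠ 0 := by
    intro hz
    have h1 := hzf s hz
    have : c / ℒ < c₀ / ℒ := div_lt_div_of_pos_right (by linarith) hℒ0
    rw [← ht] at h1
    linarith
  have hFs₁ : F s₁ ≠ 0 := h.ne_zero s₁ (by rw [hs₁re]; linarith)
  -- the package at height `t`
  obtain ⟨S, m, ψ, hS, -, hrep, hψ⟩ := h.exists_package t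
  rw [← hEdef] at hψ
  have hrep_s := hrep s hball_s hFs
  have hrep_s₁ := hrep s₁ hball_s₁ hFs₁
  have hψ_s := hψ s hmem_s
  have hψ_s₁ := hψ s₁ hmem_s₁
  -- zeros of the package: `Re a ≤ 1 − (4c₀/5)/ℒ`
  have hzero_re : ∀ a ∈ S, a.re ≤ 1 - (4 * c₀ / 5) / ℒ := by
    intro a ha
    obtain ⟨hFa, -, hda⟩ := hS a ha
    have h1 := hzf a hFa
    have him : |a.im| ≤ |t| + 1 := by
      have h2 : |(a - s₀).im| ≤ ‖a - s₀‖ := Complex.abs_im_le_norm _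
      have h3 : (a - s₀).im = a.im - t := by simp [hs₀]
      rw [h3] at h2
      have : |a.im| - |t| ≤ |a.im - t| := abs_sub_abs_le_abs_sub _ _
      linarith [hη1]
    have hell := TwistedZFR.ell_le_of_abs_le hQ him
    have hℒa : 0 < Real.log Q + Real.log (|a.im| + 4) := TwistedZFR.ell_pos hQ a.im
    have : (4 * c₀ / 5) / ℒ ≤ c₀ / (Real.log Q + Real.log (|a.im| + 4)) := by
      rw [div_le_div_iff₀ hℒ0 hℒa]
      nlinarith
    linarith
  -- geometry: `Re(s − a) ≥ (2c₀/5)/ℒ`, `Re(s₁ − a) ≥ κ`, `‖s₁ − s‖ ≤ (η/32 + η/64)/ℒ`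
  have hsub_re : ∀ a ∈ S, (2 * c₀ / 5) / ℒ ≤ (s - a).re := by
    intro a ha
    have := hzero_re a ha
    rw [sub_re]
    have h1 : c / ℒ ≤ (c₀ / 5) / ℒ := div_le_div_of_nonneg_right hc1 hℒ0.le
    have h2 : (2 * c₀ / 5) / ℒ = 2 * ((c₀ / 5) / ℒ) := by ring
    have h3 : (4 * c₀ / 5) / ℒ = 4 * ((c₀ / 5) / ℒ) := by ring
    have h4 : 0 ≤ (c₀ / 5) / ℒ := by positivity
    rw [h2]; rw [h3] at this
    linarith
  have hsub₁_re : ∀ a ∈ S, κ ≤ (s₁ - a).re := by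
    intro a ha
    have := hzero_re a ha
    rw [sub_re, hs₁re]
    have : 0 ≤ (4 * c₀ / 5) / ℒ := by positivity
    linarith
  have hs₁s : ‖s₁ - s‖ ≤ (η / 32 + η / 64) / ℒ := by
    have : s₁ - s = ((1 + κ - s.re : ℝ) : ℂ) := by
      rw [hs₁]; conv_lhs => rw [hs_eq]
      push_cast; ring
    rw [this, Complex.norm_real, Real.norm_eq_abs, abs_le]
    have h1 : c / ℒ ≤ (η / 64) / ℒ := div_le_div_of_nonneg_right hc2 hℒ0.le
    have h2 : (η / 32 + η / 64) / ℒ = κ + (η / 64) / ℒ := by rw [hκ]; ring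
    have h3 : 0 ≤ (η / 64) / ℒ := by positivity
    constructor <;> linarith
  set K₁ : ℝ := (η / 32 + η / 64) / (2 * c₀ / 5) with hK₁
  have hK₁0 : 0 ≤ K₁ := by positivity
  have hcomp : ∀ a ∈ S, ‖s₁ - s‖ ≤ K₁ * ‖s - a‖ := by
    intro a ha
    have h1 := hsub_re a ha
    have h2 : (s - a).re ≤ ‖s - a‖ := Complex.re_le_norm _
    calc ‖s₁ - s‖ ≤ (η / 32 + η / 64) / ℒ := hs₁s
      _ = K₁ * ((2 * c₀ / 5) / ℒ) := by rw [hK₁]; field_simp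
      _ ≤ K₁ * ‖s - a‖ := by gcongr; linarith
  set K₂ : ℝ := (1 + K₁) * ((η / 32 + η / 64) / (η / 32)) with hK₂
  have hK₂0 : 0 ≤ K₂ := by positivity
  -- termwise: `‖1/(s−a) − 1/(s₁−a)‖ ≤ K₂ Re 1/(s₁ − a)`
  have hterm : ∀ a ∈ S, ‖1 / (s - a) - 1 / (s₁ - a)‖ ≤ K₂ * (1 / (s₁ - a)).re := by
    intro a ha
    have hsa : s ≠ a := fun h' ↦ by
      have := hsub_re a ha; rw [h', sub_self, zero_re] at this
      have : 0 < (2 * c₀ / 5) / ℒ := by positivity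
      linarith
    have hs₁a : s₁ ≠ a := fun h' ↦ by
      have := hsub₁_re a ha; rw [h', sub_self, zero_re] at this; linarith
    have h1 := norm_inv_sub_inv_le hsa hs₁a (hcomp a ha)
    have h2 := inv_norm_sq_le_re_inv hκ0 (hsub₁_re a ha)
    calc ‖1 / (s - a) - 1 / (s₁ - a)‖ ≤ (1 + K₁) * ‖s₁ - s‖ / ‖s₁ - a‖ ^ 2 := h1
      _ = (1 + K₁) * ‖s₁ - s‖ * (1 / ‖s₁ - a‖ ^ 2) := by ring
      _ ≤ (1 + K₁) * ((η / 32 + η / 64) / ℒ) * (κ⁻¹ * (1 / (s₁ - a)).re) := by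
          have hre0 : 0 ≤ κ⁻¹ * (1 / (s₁ - a)).re := le_trans (by positivity) h2
          gcongr
      _ = K₂ * (1 / (s₁ - a)).re := by
          rw [hK₂, hκ]; field_simp
  -- the sum over the zeros, through `F'/F(s₁) = ψ(s₁) + Σ`
  have hre_div : ∀ a : ℂ, ((m a : ℂ) / (s₁ - a)).re = (m a : ℝ) * (1 / (s₁ - a)).re := by
    intro a
    rw [show (m a : ℂ) / (s₁ - a) = ((m a : ℝ) : ℂ) * (1 / (s₁ - a)) by push_cast; ring,
      Complex.re_ofReal_mul]
  have hlog₁ : ‖deriv F s₁ / F s₁‖ ≤ 32 / η * ℒ + K₀ := by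
    have h1 := h.norm_logDeriv_le_of_one_lt_re s₁ (by rw [hs₁re]; linarith)
    have hmin : min s₁.re 2 = 1 + κ := by
      rw [hs₁re]; exact min_eq_left (by linarith [hη1])
    rw [hmin, show 1 + κ - 1 = κ by ring] at h1
    have : 1 / κ = 32 / η * ℒ := by rw [hκ]; field_simp
    linarith
  have hsum_re : ∑ a ∈ S, (m a : ℝ) * (1 / (s₁ - a)).re ≤ (32 / η * ℒ + K₀) + E * ℒ := by
    have h1 : (∑ a ∈ S, (m a : ℂ) / (s₁ - a)).re = ∑ a ∈ S, (m a : ℝ) * (1 / (s₁ - a)).re := by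
      rw [Complex.re_sum]
      exact sum_congr rfl fun a _ ↦ hre_div a
    have h2 : ∑ a ∈ S, (m a : ℂ) / (s₁ - a) = deriv F s₁ / F s₁ - ψ s₁ := by
      rw [hrep_s₁]; ring
    rw [← h1, h2]
    calc (deriv F s₁ / F s₁ - ψ s₁).re ≤ ‖deriv F s₁ / F s₁ - ψ s₁‖ := Complex.re_le_norm _
      _ ≤ ‖deriv F s₁ / F s₁‖ + ‖ψ s₁‖ := norm_sub_le _ _
      _ ≤ (32 / η * ℒ + K₀) + E * ℒ := add_le_add hlog₁ hψ_s₁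
  -- the difference of the two sums
  have hdiff : ‖∑ a ∈ S, (m a : ℂ) * (1 / (s - a) - 1 / (s₁ - a))‖ ≤ K₂ * ((32 / η * ℒ + K₀) + E * ℒ) := by
    calc ‖∑ a ∈ S, (m a : ℂ) * (1 / (s - a) - 1 / (s₁ - a))‖
        ≤ ∑ a ∈ S, ‖(m a : ℂ) * (1 / (s - a) - 1 / (s₁ - a))‖ := norm_sum_le _ _
      _ ≤ ∑ a ∈ S, (m a : ℝ) * (K₂ * (1 / (s₁ - a)).re) := by
          refine sum_le_sum fun a ha ↦ ?_
          rw [norm_mul, Complex.norm_natCast]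
          exact mul_le_mul_of_nonneg_left (hterm a ha) (Nat.cast_nonneg _)
      _ = K₂ * ∑ a ∈ S, (m a : ℝ) * (1 / (s₁ - a)).re := by rw [mul_sum]; exact sum_congr rfl fun a _ ↦ by ring
      _ ≤ K₂ * ((32 / η * ℒ + K₀) + E * ℒ) := mul_le_mul_of_nonneg_left hsum_re hK₂0
  -- assemble: `F'/F(s) = F'/F(s₁) + (ψ s − ψ s₁) + Σ m(a)(1/(s−a) − 1/(s₁−a))`
  have hmain : deriv F s / F s = deriv F s₁ / F s₁ + (ψ s - ψ s₁) +
      ∑ a ∈ S, (m a : ℂ) * (1 / (s - a) - 1 / (s₁ - a)) := by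
    have e1 : deriv F s / F s = ψ s + ∑ a ∈ S, (m a : ℂ) / (s - a) := by rw [hrep_s]; ring
    have e2 : deriv F s₁ / F s₁ = ψ s₁ + ∑ a ∈ S, (m a : ℂ) / (s₁ - a) := by rw [hrep_s₁]; ring
    rw [e1, e2]
    simp only [mul_sub, sum_sub_distrib, div_eq_mul_one_div (m _ : ℂ)]
    ring
  refine ⟨hFs, ?_⟩
  have hψψ : ‖ψ s - ψ s₁‖ ≤ 2 * E * ℒ := by
    calc ‖ψ s - ψ s₁‖ ≤ ‖ψ s‖ + ‖ψ s₁‖ := norm_sub_le _ _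
      _ ≤ E * ℒ + E * ℒ := add_le_add hψ_s hψ_s₁
      _ = 2 * E * ℒ := by ring
  calc ‖deriv F s / F s‖
      = ‖deriv F s₁ / F s₁ + (ψ s - ψ s₁) + ∑ a ∈ S, (m a : ℂ) * (1 / (s - a) - 1 / (s₁ - a))‖ := by
        rw [hmain]
    _ ≤ ‖deriv F s₁ / F s₁‖ + ‖ψ s - ψ s₁‖ + ‖∑ a ∈ S, (m a : ℂ) * (1 / (s - a) - 1 / (s₁ - a))‖ := by
        refine (norm_add_le _ _).trans (add_le_add (norm_add_le _ _) le_rfl)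
    _ ≤ (32 / η * ℒ + K₀) + 2 * E * ℒ + K₂ * ((32 / η * ℒ + K₀) + E * ℒ) :=
        add_le_add (add_le_add hlog₁ hψψ) hdiff
    _ ≤ (32 / η + K₀ + 2 * E + K₂ * (32 / η + K₀ + E)) * ℒ := by
        have h32 : 0 ≤ 32 / η := by positivity
        have hK₀ℒ : K₀ ≤ K₀ * ℒ := le_mul_of_one_le_right hK₀ hℒ1
        nlinarith [mul_nonneg hK₂0 hK₀, mul_nonneg hK₂0 (sub_nonneg.mpr hK₀ℒ)]
    _ = (32 / η + K₀ + 2 * E +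
        (1 + (η / 32 + η / 64) / (2 * c₀ / 5)) * ((η / 32 + η / 64) / (η / 32)) * (32 / η + K₀ + E)) * ℒ := by
        rw [hK₂, hK₁]

/-- **`F⁻¹ ≪ ℒ` near `σ = 1` (no exceptional zero)**: under the hypotheses of
`norm_logDeriv_le_sharp`, for `1 − c/ℒ(t) ≤ σ ≤ 1 + η/(32ℒ(t))`,
`‖F(s)⁻¹‖ ≤ (32/(c₁η)) exp(C_sharp (η/32 + η/64)) ℒ(t)`: integrate `F'/F` along the horizontal
segment to `s₁ = 1 + η/(32ℒ) + it` (Gronwall: `‖F(s₁)‖ ≤ ‖F(s)‖ e^{Cℒ(σ₁−σ)}`) and use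
`‖F(s₁)‖ ≥ c₁(σ₁ − 1) = c₁η/(32ℒ)`. [cite: MontgomeryVaughan2007, Theorem 11.4] -/
theorem norm_inv_le_sharp {c₀ : ℝ} (hc₀ : 0 < c₀)
    (hzf : ∀ ρ : ℂ, F ρ = 0 → ρ.re ≤ 1 - c₀ / (Real.log Q + Real.log (|ρ.im| + 4)))
    {s : ℂ} (hσ1 : 1 - min (c₀ / 5) (η / 64) / (Real.log Q + Real.log (|s.im| + 4)) ≤ s.re)
    (hσ2 : s.re ≤ 1 + η / 32 / (Real.log Q + Real.log (|s.im| + 4))) :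
    ‖(F s)⁻¹‖ ≤ 32 / (c₁ * η) *
      Real.exp ((32 / η + K₀ + 2 * E[η, A, Cg, c₁] +
        (1 + (η / 32 + η / 64) / (2 * c₀ / 5)) * ((η / 32 + η / 64) / (η / 32)) * (32 / η + K₀ + E[η, A, Cg, c₁])) *
        (η / 32 + η / 64)) * (Real.log Q + Real.log (|s.im| + 4)) := by
  have hη := h.eta_pos
  have hη1 := h.eta_le_one
  have hK₀ := h.K₀_nonneg
  have hQ := h.one_le_Q
  have hc₁ := h.c₁_pos
  obtain ⟨CS, hCS⟩ : ∃ CS : ℝ, CS = (32 / η + K₀ + 2 * E[η, A, Cg, c₁] +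
      (1 + (η / 32 + η / 64) / (2 * c₀ / 5)) * ((η / 32 + η / 64) / (η / 32)) * (32 / η + K₀ + E[η, A, Cg, c₁])) :=
    ⟨_, rfl⟩
  have hCS0 : 0 ≤ CS := by
    rw [hCS]; have := h.packageConst_nonneg; positivity
  rw [← hCS]
  set t : ℝ := s.im with ht
  set ℒ : ℝ := Real.log Q + Real.log (|t| + 4) with hℒ
  have hℒ1 : 1 ≤ ℒ := TwistedZFR.one_le_ell hQ t
  have hℒ0 : 0 < ℒ := by linarith
  set κ : ℝ := η / 32 / ℒ with hκ
  have hκ0 : 0 < κ := by positivity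
  have hκ1 : κ ≤ 1 := by
    rw [hκ]; exact (div_le_self (by positivity) hℒ1).trans (by linarith)
  set σ₁ : ℝ := 1 + κ with hσ₁
  have hσσ₁ : s.re ≤ σ₁ := hσ2
  -- the path `u ↦ F(u + it)` on `[σ, σ₁]`
  set f : ℝ → ℂ := fun u ↦ F ((u : ℂ) + t * I) with hf
  have hpt : ∀ u : ℝ, ((u : ℂ) + t * I).re = u ∧ ((u : ℂ) + t * I).im = t := fun u ↦ by
    constructor <;> simp
  have hsharp : ∀ u : ℝ, s.re ≤ u → u ≤ σ₁ →
      F ((u : ℂ) + t * I) ≠ 0 ∧ ‖deriv F ((u : ℂ) + t * I) / F ((u : ℂ) + t * I)‖ ≤ CS * ℒ := by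
    intro u hu1 hu2
    have h1 := h.norm_logDeriv_le_sharp hc₀ hzf (s := (u : ℂ) + t * I)
      (by rw [(hpt u).1, (hpt u).2]; exact hσ1.trans hu1) (by rw [(hpt u).1, (hpt u).2]; exact hu2)
    rw [(hpt u).2, ← hCS] at h1
    exact h1
  have hdiffF : ∀ u : ℝ, s.re ≤ u → DifferentiableAt ℂ F ((u : ℂ) + t * I) := by
    intro u hu
    refine h.differentiableOn.differentiableAt ((isOpen_lt continuous_const Complex.continuous_re).mem_nhds ?_)
    show 1 - η < ((u : ℂ) + t * I).re
    rw [(hpt u).1]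
    have : min (c₀ / 5) (η / 64) / ℒ ≤ η / 64 := (div_le_self (by positivity) hℒ1).trans (min_le_right _ _)
    linarith
  have hderiv : ∀ u : ℝ, s.re ≤ u → HasDerivAt f (deriv F ((u : ℂ) + t * I)) u := by
    intro u hu
    have h1 : HasDerivAt (fun w : ℂ ↦ F (w + t * I)) (deriv F ((u : ℂ) + t * I)) (u : ℂ) := by
      have := ((hdiffF u hu).hasDerivAt).comp (u : ℂ) ((hasDerivAt_id (u : ℂ)).add_const (t * I))
      simpa [Function.comp_def] using this
    exact h1.comp_ofReal
  have hcont : ContinuousOn f (Icc s.re σ₁) := fun u hu ↦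
    (hderiv u hu.1).continuousAt.continuousWithinAt
  have hgron := norm_le_gronwallBound_of_norm_deriv_right_le (f := f)
    (f' := fun u ↦ deriv F ((u : ℂ) + t * I)) (δ := ‖f s.re‖) (K := CS * ℒ) (ε := 0) (a := s.re) (b := σ₁)
    hcont (fun u hu ↦ (hderiv u hu.1).hasDerivWithinAt) le_rfl
    (fun u hu ↦ by
      obtain ⟨hne, hb⟩ := hsharp u hu.1 hu.2.le
      rw [add_zero]
      have hFpos : 0 < ‖F ((u : ℂ) + t * I)‖ := norm_pos_iff.mpr hne
      rw [norm_div, div_le_iff₀ hFpos] at hb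
      exact hb)
    σ₁ ⟨hσσ₁, le_rfl⟩
  rw [gronwallBound_ε0] at hgron
  -- `‖F(s₁)‖ ≥ c₁ κ`
  have hlow : c₁ * κ ≤ ‖f σ₁‖ := by
    have := h.lower ((σ₁ : ℂ) + t * I) (by rw [(hpt σ₁).1, hσ₁]; linarith)
      (by rw [(hpt σ₁).1, hσ₁]; linarith)
    rw [(hpt σ₁).1, hσ₁, show 1 + κ - 1 = κ by ring] at this
    exact this
  -- the exponent: `CS ℒ (σ₁ − σ) ≤ CS (η/32 + η/64)`
  have hexp : Real.exp (CS * ℒ * (σ₁ - s.re)) ≤ Real.exp (CS * (η / 32 + η / 64)) := by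
    apply Real.exp_le_exp.mpr
    have h1 : σ₁ - s.re ≤ (η / 32 + η / 64) / ℒ := by
      have hc : min (c₀ / 5) (η / 64) / ℒ ≤ (η / 64) / ℒ :=
        div_le_div_of_nonneg_right (min_le_right _ _) hℒ0.le
      rw [hσ₁, hκ, add_div]
      linarith
    calc CS * ℒ * (σ₁ - s.re) ≤ CS * ℒ * ((η / 32 + η / 64) / ℒ) := by
          apply mul_le_mul_of_nonneg_left h1; positivity
      _ = CS * (η / 32 + η / 64) := by field_simp
  have hfs : f s.re = F s := by
    rw [hf]
    simp only
    congr 1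
    apply Complex.ext <;> simp [ht]
  set K₃ : ℝ := Real.exp (CS * (η / 32 + η / 64)) with hK₃
  have hK₃0 : 0 < K₃ := Real.exp_pos _
  have hFs : F s ≠ 0 := (hsharp s.re le_rfl hσσ₁).1 |> fun hne ↦ by
    have : ((s.re : ℂ) + t * I) = s := by apply Complex.ext <;> simp [ht]
    rwa [this] at hne
  have hchain : c₁ * κ ≤ ‖F s‖ * K₃ := by
    calc c₁ * κ ≤ ‖f σ₁‖ := hlow
      _ ≤ ‖f s.re‖ * Real.exp (CS * ℒ * (σ₁ - s.re)) := hgron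
      _ ≤ ‖F s‖ * K₃ := by rw [hfs]; gcongr
  have hFpos : 0 < ‖F s‖ := norm_pos_iff.mpr hFs
  rw [norm_inv]
  rw [inv_le_iff_one_le_mul₀ hFpos]
  -- `1 ≤ ‖F s‖ · (32/(c₁η)) K₃ ℒ` from `c₁ κ ≤ ‖F s‖ K₃`, `κ = η/(32ℒ)`
  have h1 : c₁ * κ * (32 / (c₁ * η) * ℒ) = 1 := by
    rw [hκ]; field_simp
  calc (1 : ℝ) = c₁ * κ * (32 / (c₁ * η) * ℒ) := h1.symm
    _ ≤ ‖F s‖ * K₃ * (32 / (c₁ * η) * ℒ) := by gcongr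
    _ = 32 / (c₁ * η) * K₃ * ℒ * ‖F s‖ := by ring

end Sharp

end TwistedZFRData

end Literature.NumberTheory.LFunctions
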